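import Summits.ABC.ABC.Theorems.DefiniteXiFreyModularityStubAbsIrrNegThree
import Literature.NumberTheory.EllipticCurves.SerreOpenImageSupersingularFrobeniusProofs
import Literature.NumberTheory.EllipticCurves.OpenImageMazurFrobeniusProofs
import Literature.NumberTheory.Automorphic.LanglandsTunnellModThree
import Literature.NumberTheory.Automorphic.TunnellOctahedralGlobal
import Literature.NumberTheory.Automorphic.StrongArtinGL2
import Literature.NumberTheory.Automorphic.PiOfArtinRepFrobSatakeCompatibleProofs
import Literature.NumberTheory.Automorphic.ArthurClozelNilpotentStrongArtin
import Literature.NumberTheory.Automorphic.ArtinLFunctionsProofs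
import Literature.NumberTheory.Automorphic.BookerStrongArtin
import Literature.NumberTheory.Automorphic.CDTTheorem712TwoLiftsProofs
import Literature.NumberTheory.Automorphic.CDTTheorem722
import Literature.NumberTheory.Automorphic.BCDTTheoremB
import Literature.NumberTheory.GaloisRepresentations.IntegralGaloisAction
import Literature.NumberTheory.GaloisRepresentations.ArtinRestriction
import Mathlib.GroupTheory.Perm.Sign
import HarnessLib

/-!
# Stub ideas, `stub_modThree`, ideator k = 3, GENERATION 7 — "THE TWO EXTREMES OF THE INPUT"

Companion to `STUB-IDEAS-stub_modThree-3.md` (generation 7).  Home family 3 (probe the extremes).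

Generations 4–6 of this ideator localised the octahedral input at ONE PLACE (the pin at `v = 3`,
generation 6: Langlands 1980 Thm 3.5 verbatim, `Langlands1980_thm35`).  Generation 7 probes the two
remaining extremes of the SAME input and types what each buys:

* **§A — the HOLOMORPHY extreme (minimal hypothesis).**  On this line the octahedral theorem is
  consumed only as "a weight-one newform for `σ = Ψ ∘ ρ̄`".  The tree ALREADY carries the two facts
  that make this equivalent to ARTIN'S CONJECTURE FOR `σ` ALONE — `booker_strongArtin_of_artinConjecture`
  (Booker, Ann. of Math. 158 (2003), Cor. p. 1090: `L(s, ρ)` entire ⇒ `π(ρ)` exists, over `ℚ`, either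
  parity, no twists) and the Gelbart-4.2 dictionary `exists_isNewform1_of_isPiOfArtinRep` — and it
  carries the Artin side of Langlands–Tunnell as the CLOSED fact
  `langlands_tunnell_hasEntireContinuation` (Tunnell 1981, Theorem: "hence `L(ρ, s)` is entire").
  Kernel-checked here: `langlands_tunnell_of_artinConjecture` (those three ⇒ `∀ σ, langlands_tunnell σ`),
  the closer `stub_modThree_of_artinConjecture`, the per-`σ` EQUIVALENCE
  `langlands_tunnell_iff_artinHolomorphy`, and the exact transcendental content of the stub on this
  road, `ArtinHolomorphyModThree` (Artin's conjecture for the `S̃₄`/`2`-group fields `ℚ(E[3])`).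
  No automorphic representation over any field other than `ℚ`, no base change, no new named fact.
* **§B — the pin at EVERY non-split place (maximal reach of Thm 3.5).**  Thm 3.5 needs `ρ_v`
  dihedral at SOME `v` not split in `E = ℚ(√-3)`, i.e. `v = 3` OR `v = ℓ ≡ 2 (mod 3)` (and `v = 2`).
  At a potentially multiplicative `ℓ ≡ 2 (3)` with `3 ∤ v_ℓ(j)` the pin is automatic: a transvection
  in `ρ̄(I_ℓ)` (Silverman ATAEC V.6.1) and `det ρ̄(Frob_ℓ) = χ̄₃(Frob_ℓ) = ℓ ≡ -1` force `ρ̄(D_ℓ)`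
  non-abelian inside a Borel (B2–B5).  For Frey curves: every ODD `ℓ ∣ abc`, `ℓ ≡ 2 (3)`,
  `3 ∤ v_ℓ(abc)` pins (B6), and `2` pins when `v₂(abc) ≥ 5`, `v₂(abc) ≢ 1 (3)` (B6₂).  The switch the
  residual cell needs is then only `SwitchToPinned` (B7) — implied by generation 5's `SwitchTateAtThree`.

Sorries only in the helper stubs marked `:= by sorry` (each one prover cycle; sizes in the .md).
-/

-- `Summit.<Summit>.<Problem>` doubles `ABC` deliberately (CONVENTIONS §2).
set_option linter.dupNamespace false

noncomputable section

open scoped MatrixGroups NumberField Polynomial Classical Pointwise ModularForm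
open NumberField IsDedekindDomain Field Polynomial Filter Matrix CongruenceSubgroup
open Literature.NumberTheory.EllipticCurves
open Literature.NumberTheory.GaloisRepresentations Literature.NumberTheory.Automorphic
open Literature.NumberTheory.Automorphic.BCDT
open WeierstrassCurve

namespace Summit.ABC.ABC.Cruxes.FreyModularity.StubIdeasModThree3G7

/-! ### §0 The stub, verbatim -/

/-- The registered stub's signature (`Lines/Sketch.lean`, `stub_modThree`), verbatim. -/
abbrev SigStubModThree : Prop :=
  ∀ (W : WeierstrassCurve ℚ) [W.IsElliptic] (ρ : ModPGaloisRep ℚ (ZMod 3) 2),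
    W.IsTorsionGaloisRep 3 ρ → FramedRep.IsAbsolutelyIrreducible ρ → ρ.IsModular

/-! ### §A THE HOLOMORPHY EXTREME — everything below is PROVED except the port H1 -/

/-- **(A1′) Langlands–Tunnell at ONE `σ` from Artin holomorphy at that `σ`** (PROVED): granted
Booker 2003 (tree fact `booker_strongArtin_of_artinConjecture`) and Gelbart Prop. 4.2 (tree fact
`exists_isNewform1_of_isPiOfArtinRep`; Prop. 4.1 is the tree THEOREM
`frobSatakeCompatibleAt_of_isPiOfArtinRep_holds`), the "hence" clause of lang.S30 at `σ`
(`hasEntireContinuation_artinLFunction_of_isSolvable σ`: `L(s, σ)` entire if `σ` is irreducible, odd,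
solvable) implies `langlands_tunnell σ`.  Booker's conclusion is the definiens of `IsPiOfArtinRep`.
[cite: Booker2003, Corollary (p. 1090)] [cite: Gelbart1997, Prop. 4.2] -/
theorem langlands_tunnell_of_artinHolomorphyAt (hB : booker_strongArtin_of_artinConjecture)
    (hW1 : exists_isNewform1_of_isPiOfArtinRep) (σ : FramedArtinRep ℚ 2)
    (hA : hasEntireContinuation_artinLFunction_of_isSolvable σ) : langlands_tunnell σ := by
  intro hirr hodd hsolv
  obtain ⟨hcpt, π, hπ⟩ := hB σ hirr (hA hirr hodd hsolv)
  have hπ' : IsPiOfArtinRep σ π.1 := (isPiOfArtinRep_iff σ π.1).mpr hπ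
  obtain ⟨N, hN, f, hf, -, hsat⟩ := hW1 hcpt σ π hirr hodd hπ'
  refine ⟨N, hN, f, hf, fun v hv => ?_⟩
  obtain ⟨α, hα, hpoly⟩ := hsat v hv
  obtain ⟨hur, hchar⟩ := frobSatakeCompatibleAt_of_isPiOfArtinRep_holds hcpt σ π hπ' v α hα
  exact ⟨hur, hpoly ▸ hchar⟩

/-- **(A1) THE LANGLANDS–TUNNELL THEOREM FROM THREE FACTS ALREADY IN THE TREE, none of them a
base-change statement** (PROVED): Artin's conjecture for odd solvable `σ : Γ_ℚ → GL₂(ℂ)` (the CLOSED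
fact `langlands_tunnell_hasEntireContinuation` = Tunnell 1981, Theorem, "hence `L(ρ, s)` is entire")
+ Booker 2003 + Gelbart 4.2.  Compare the tree's `langlands_tunnell_of_strongArtin`, whose first
input `strongArtin_of_isSolvable` quantifies over EVERY number field.
[cite: Tunnell1981, Theorem] [cite: Booker2003, Corollary (p. 1090)] [cite: Gelbart1997, Prop. 4.2] -/
theorem langlands_tunnell_of_artinConjecture (hAE : langlands_tunnell_hasEntireContinuation)
    (hB : booker_strongArtin_of_artinConjecture) (hW1 : exists_isNewform1_of_isPiOfArtinRep)
    (σ : FramedArtinRep ℚ 2) : langlands_tunnell σ :=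
  langlands_tunnell_of_artinHolomorphyAt hB hW1 σ fun hirr hodd hsolv ↦ hAE σ hirr hodd hsolv

/-- **(A2) THE STUB FROM ARTIN HOLOMORPHY (PROVED closer)** — `stub_modThree` is exactly
{`langlands_tunnell_hasEntireContinuation`, `booker_strongArtin_of_artinConjecture`,
`exists_isNewform1_of_isPiOfArtinRep`} away, via the tree's `modThree_of_langlands_tunnell`.
[cite: ConradDiamondTaylor1999, Thm. 7.2.1 (proof, p. 553)] -/
theorem stub_modThree_of_artinConjecture (hAE : langlands_tunnell_hasEntireContinuation)
    (hB : booker_strongArtin_of_artinConjecture) (hW1 : exists_isNewform1_of_isPiOfArtinRep) :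
    SigStubModThree :=
  modThree_of_langlands_tunnell (langlands_tunnell_of_artinConjecture hAE hB hW1)

/-- **(A3) THE EQUIVALENCE (PROVED)**: granted Booker 2003, Gelbart 4.2 and the Deligne–Serre
comparison `L(s, ρ) = L(s, f)` (tree fact `artinLFunction_eq_cuspFormLSeries`; Hecke's entirety of
weight-one `L(s, f)` is the tree theorem `hasEntireContinuation_cuspFormLSeries_of_weight_one`),
weight-one modularity of `σ` and Artin holomorphy of `σ` are THE SAME STATEMENT:
`langlands_tunnell σ ↔ hasEntireContinuation_artinLFunction_of_isSolvable σ`.  So on this road the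
stub's transcendental content is Artin's conjecture, nothing more.
[cite: Booker2003, Corollary (p. 1090)] [cite: DeligneSerreASENS1974, Thm. 4.1, Thm. 4.6 (b)] -/
theorem langlands_tunnell_iff_artinHolomorphy (hB : booker_strongArtin_of_artinConjecture)
    (hW1 : exists_isNewform1_of_isPiOfArtinRep) (σ : FramedArtinRep ℚ 2)
    (hDS : ∀ {N : ℕ} [NeZero N] {f : CuspForm (Gamma1 N) 1},
      artinLFunction_eq_cuspFormLSeries (f := f) (ρ := σ)) :
    langlands_tunnell σ ↔ hasEntireContinuation_artinLFunction_of_isSolvable σ :=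
  ⟨fun h ↦ hasEntireContinuation_artinLFunction_of_isSolvable_of_langlands_tunnell σ h hDS,
    fun h ↦ langlands_tunnell_of_artinHolomorphyAt hB hW1 σ h⟩

/-- **(A4) THE EXACT TRANSCENDENTAL CONTENT OF THE STUB ON THE HOLOMORPHY ROAD** — Artin's
conjecture for the lifts `σ = Ψ ∘ ρ̄` of the absolutely irreducible odd `ρ̄ : Γ_ℚ → GL₂(𝔽₃)` (image
`GL₂(𝔽₃) = S̃₄` or a `2`-group; Artin `L`-functions of degree `2` of the fields `ℚ(E[3])`):
`L(s, Ψ ∘ ρ̄)` has an entire continuation.  A `Prop`, not a fact: it is IMPLIED by the closed fact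
`langlands_tunnell_hasEntireContinuation` (A4a) and it IMPLIES the stub (A4b).
[cite: Tunnell1981, p. 173] -/
def ArtinHolomorphyModThree : Prop :=
  ∀ ρ : ModPGaloisRep ℚ (ZMod 3) 2, FramedRep.IsAbsolutelyIrreducible ρ → FramedGaloisRep.IsOdd ρ →
    LFunction.HasEntireContinuation (artinLFunction (FramedArtinRep.toArtinRep (modThreeLift ρ)))

/-- (A4a, PROVED) the closed tree fact gives `ArtinHolomorphyModThree` (`GL₂(𝔽₃)` is solvable:
`isSolvable_range_modThreeLift`; `Ψ ∘ ρ̄` irreducible and odd: `isIrreducible_modThreeLift`,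
`isOdd_modThreeLift`). [cite: Tunnell1981, Theorem] -/
theorem artinHolomorphyModThree_of_langlands_tunnell_hasEntireContinuation
    (hAE : langlands_tunnell_hasEntireContinuation) : ArtinHolomorphyModThree :=
  fun ρ habs hodd ↦ hAE (modThreeLift ρ) (isIrreducible_modThreeLift habs) (isOdd_modThreeLift hodd)
    (isSolvable_range_modThreeLift ρ)

/-- **(H1) Langlands–Tunnell at `σ = Ψ ∘ ρ̄` ⇒ `ρ̄` modular — PROVED by k = 1**
(`isModular_of_langlands_tunnell_at`, 0 sorries, crux dir `STUB_IDEAS_stub_modThree_1.lean`: the tree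
proof of `ModPGaloisRep.isModular_of_isAbsolutelyIrreducible_of_isOdd_of_langlands_tunnell`
localised to one `σ`); restated because crux-dir files are not built on the farm (port, `S`).
[cite: DiamondShurman2005, Thm. 9.6.3] -/
theorem isModular_of_langlands_tunnell_at (ρ : ModPGaloisRep ℚ (ZMod 3) 2)
    (hLT : langlands_tunnell (modThreeLift ρ)) (habs : FramedRep.IsAbsolutelyIrreducible ρ)
    (hodd : FramedGaloisRep.IsOdd ρ) : ρ.IsModular := by
  sorry

/-- Oddness of `ρ̄ = E[3]` from `det ρ̄ = χ̄₃` (PROVED, generations 4–6 verbatim). -/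
theorem isOdd_of_isTorsionGaloisRep (W : WeierstrassCurve ℚ) [W.IsElliptic]
    (ρ : ModPGaloisRep ℚ (ZMod 3) 2) (hρ : W.IsTorsionGaloisRep 3 ρ) : FramedGaloisRep.IsOdd ρ := by
  haveI : NeZero ((3 : ℕ) : ℚ) := ⟨by norm_num⟩
  intro φ c hc
  rw [W.det_eq_modPCyclotomicCharacter_of_isTorsionGaloisRep_holds 3 ρ hρ c]
  ext
  rw [modPCyclotomicCharacterZMod_eq_modNCyclotomicCharacter,
    modNCyclotomicCharacter_of_isComplexConjugation hc, Units.val_neg, Units.val_one]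

/-- **(A4b, PROVED from H1) the stub from `ArtinHolomorphyModThree`** + Booker + Gelbart 4.2. -/
theorem stub_modThree_of_artinHolomorphyModThree (hA : ArtinHolomorphyModThree)
    (hB : booker_strongArtin_of_artinConjecture) (hW1 : exists_isNewform1_of_isPiOfArtinRep) :
    SigStubModThree := by
  intro W _ ρ hρ habs
  have hodd : FramedGaloisRep.IsOdd ρ := isOdd_of_isTorsionGaloisRep W ρ hρ
  refine isModular_of_langlands_tunnell_at ρ ?_ habs hodd
  exact langlands_tunnell_of_artinHolomorphyAt hB hW1 (modThreeLift ρ) fun _ _ _ ↦ hA ρ habs hodd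

/-! ### §B THE PIN AT EVERY NON-SPLIT PLACE -/

/-- **THE GEN-7 PIN AT A PRIME `p`** (generation 6's `HasLanglandsPinAtThree` with `3` replaced by
any prime `p`): above `p` there is a prime `𝔔` with (i) `ρ̄(D_𝔔)` non-abelian, (ii) some `τ ∈ D_𝔔`
with `det ρ̄(τ) = -1` (`p` does not split in `E = ℚ(√-3)`), (iii) `ρ̄(D_𝔔)` misses an element of
`SL₂(𝔽₃)` (`σ_p` not primitive).  The place is given by `(p : 𝓞 ℚ) ∈ v.asIdeal`. -/
def HasLanglandsPinAt (p : ℕ) (ρ : ModPGaloisRep ℚ (ZMod 3) 2) : Prop :=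
  ∃ (v : HeightOneSpectrum (𝓞 ℚ)) (_ : (p : 𝓞 ℚ) ∈ v.asIdeal) (𝔔 : Ideal (absIntegers (𝓞 ℚ) ℚ)),
    𝔔 ∈ v.primesAbove ∧
    (∃ τ₁ ∈ 𝔔.decompositionSubgroup (Field.absoluteGaloisGroup ℚ),
      ∃ τ₂ ∈ 𝔔.decompositionSubgroup (Field.absoluteGaloisGroup ℚ), ρ τ₁ * ρ τ₂ ≠ ρ τ₂ * ρ τ₁) ∧
    (∃ τ ∈ 𝔔.decompositionSubgroup (Field.absoluteGaloisGroup ℚ),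
      Matrix.GeneralLinearGroup.det (ρ τ) = -1) ∧
    (∃ g : GL (Fin 2) (ZMod 3), Matrix.GeneralLinearGroup.det g = 1 ∧
      ∀ τ ∈ 𝔔.decompositionSubgroup (Field.absoluteGaloisGroup ℚ), ρ τ ≠ g)

/-- **THE GEN-7 PIN**: pinned at `3` or at some prime `p ≡ 2 (mod 3)` (the primes not split in
`ℚ(√-3)`; `p = 2` included). -/
def HasLanglandsPin (ρ : ModPGaloisRep ℚ (ZMod 3) 2) : Prop :=
  ∃ p : ℕ, p.Prime ∧ (p = 3 ∨ p % 3 = 2) ∧ HasLanglandsPinAt p ρ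

/-- The gen-7 pinned stub. -/
abbrev SigStubModThreePinned : Prop :=
  ∀ (W : WeierstrassCurve ℚ) [W.IsElliptic] (ρ : ModPGaloisRep ℚ (ZMod 3) 2),
    W.IsTorsionGaloisRep 3 ρ → FramedRep.IsAbsolutelyIrreducible ρ → HasLanglandsPin ρ → ρ.IsModular

/-- The canonical map onto the projective image (generation 6, verbatim). [folklore] -/
def projHom (σ : FramedArtinRep ℚ 2) :
    Field.absoluteGaloisGroup ℚ →* projectiveImage σ.toMonoidHom :=
  (rangeToProjectiveImage σ.toMonoidHom).comp σ.toMonoidHom.rangeRestrict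

/-- "`ρ_v` is dihedral" (generation 6, verbatim): `σ|_{D_𝔓}` has dihedral projective image. -/
def IsLocallyDihedralAt (σ : FramedArtinRep ℚ 2) (𝔓 : Ideal (absIntegers (𝓞 ℚ) ℚ)) : Prop :=
  IsDihedralType (σ.toMonoidHom.restrict (𝔓.decompositionSubgroup (Field.absoluteGaloisGroup ℚ)))

/-- **(T1) Langlands 1980 Thm 3.5, verbatim — generation 6's named fact, unchanged** (it already
quantifies over ANY non-split place `v`). [cite: LanglandsBaseChange1980, §3 Thm. 3.5 (p. 20), §2 (c) (p. 16)] -/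
def Langlands1980_thm35 : Prop :=
  ∀ (σ : FramedArtinRep ℚ 2) (e : projectiveImage σ.toMonoidHom ≃* Equiv.Perm (Fin 4)),
    σ.toGaloisRep.IsIrreducible → σ.IsOdd →
    (∀ (φ : ℚ →+* ℝ) (c : Field.absoluteGaloisGroup ℚ), IsComplexConjugation φ c →
        Equiv.Perm.sign (e (projHom σ c)) = -1) →
    (∃ (v : HeightOneSpectrum (𝓞 ℚ)) (𝔓 : Ideal (absIntegers (𝓞 ℚ) ℚ)), 𝔓 ∈ v.primesAbove ∧
        (∃ τ ∈ 𝔓.decompositionSubgroup (Field.absoluteGaloisGroup ℚ),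
          Equiv.Perm.sign (e (projHom σ τ)) = -1) ∧
        IsLocallyDihedralAt σ 𝔓) →
    ∃ (hcpt : isCompact_glFiniteIntegralLevel 2 ℚ) (π : CuspidalAutomorphicRepData 2 ℚ hcpt),
      IsPiOfArtinRep σ π.1

/-- **(B1) Thm 3.5's hypotheses for `σ = Ψ ∘ ρ̄` from the gen-7 pin, `M`** (= generation 6's
C1 ✓ + C2 + C3 + C5 verbatim with `𝔔` over ANY prime: octahedral type with its `e`; `sign ∘ e = det`
so oddness gives the edge axis and bit (ii) gives the non-split witness; bits (i)+(iii) give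
`IsLocallyDihedralAt` by the subgroup list of `GL₂(𝔽₃)`). [cite: Serre1972, §2.5–2.6] [folklore] -/
theorem thm35_hypotheses_of_hasLanglandsPin (ρ : ModPGaloisRep ℚ (ZMod 3) 2)
    (hs : Function.Surjective ρ) (hodd : FramedGaloisRep.IsOdd ρ) (hpin : HasLanglandsPin ρ) :
    ∃ e : projectiveImage (modThreeLift ρ).toMonoidHom ≃* Equiv.Perm (Fin 4),
      (∀ (φ : ℚ →+* ℝ) (c : Field.absoluteGaloisGroup ℚ), IsComplexConjugation φ c →
        Equiv.Perm.sign (e (projHom (modThreeLift ρ) c)) = -1) ∧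
      ∃ (v : HeightOneSpectrum (𝓞 ℚ)) (𝔓 : Ideal (absIntegers (𝓞 ℚ) ℚ)), 𝔓 ∈ v.primesAbove ∧
        (∃ τ ∈ 𝔓.decompositionSubgroup (Field.absoluteGaloisGroup ℚ),
          Equiv.Perm.sign (e (projHom (modThreeLift ρ) τ)) = -1) ∧
        IsLocallyDihedralAt (modThreeLift ρ) 𝔓 := by
  sorry

/-- **(D3, PROVED from T1 + B1) `π(σ)` exists for surjective `ρ̄` pinned ANYWHERE non-split.**
[cite: LanglandsBaseChange1980, §3 Thm. 3.5] -/
theorem exists_isPiOfArtinRep_of_hasLanglandsPin (h35 : Langlands1980_thm35)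
    (ρ : ModPGaloisRep ℚ (ZMod 3) 2) (hs : Function.Surjective ρ)
    (habs : FramedRep.IsAbsolutelyIrreducible ρ) (hodd : FramedGaloisRep.IsOdd ρ)
    (hpin : HasLanglandsPin ρ) :
    ∃ (hcpt : isCompact_glFiniteIntegralLevel 2 ℚ) (π : CuspidalAutomorphicRepData 2 ℚ hcpt),
      IsPiOfArtinRep (modThreeLift ρ) π.1 := by
  obtain ⟨e, hedge, hv⟩ := thm35_hypotheses_of_hasLanglandsPin ρ hs hodd hpin
  exact h35 (modThreeLift ρ) e
    ((FramedRep.isIrreducible_toContinuousRep_iff _).mpr (isIrreducible_modThreeLift habs))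
    (isOdd_modThreeLift hodd) hedge hv

/-- **(N1⁶) the non-surjective branch — PROVED by k = 1 gen 6** (image a `2`-group ⇒ nilpotent ⇒
Arthur–Clozel); restated (port, `S`). [cite: ArthurClozelAMS120, Ch. 3 Thm. 7.1] -/
theorem exists_isPiOfArtinRep_of_not_surjective (hAC : ArthurClozel1989_strongArtin_nilpotent)
    (ρ : ModPGaloisRep ℚ (ZMod 3) 2) (habs : FramedRep.IsAbsolutelyIrreducible ρ)
    (hodd : FramedGaloisRep.IsOdd ρ) (hs : ¬ Function.Surjective ρ) :
    ∃ (hcpt : isCompact_glFiniteIntegralLevel 2 ℚ) (π : CuspidalAutomorphicRepData 2 ℚ hcpt),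
      IsPiOfArtinRep (modThreeLift ρ) π.1 := by
  sorry

/-- **THE GEN-7 PINNED STUB FROM THREE FACTS (PROVED modulo B1, H1, N1⁶)** — as generation 6's
`sigPinned_of_three_facts`, now on the larger pinned locus. -/
theorem sigPinned_of_three_facts (hAC : ArthurClozel1989_strongArtin_nilpotent)
    (h35 : Langlands1980_thm35) (hW1 : exists_isNewform1_of_isPiOfArtinRep) :
    SigStubModThreePinned := by
  intro W _ ρ hρ habs hpin
  have hodd : FramedGaloisRep.IsOdd ρ := isOdd_of_isTorsionGaloisRep W ρ hρ
  refine isModular_of_langlands_tunnell_at ρ ?_ habs hodd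
  intro hirr hodd' _
  by_cases hs : Function.Surjective ρ
  · obtain ⟨hcpt, π, hπ⟩ := exists_isPiOfArtinRep_of_hasLanglandsPin h35 ρ hs habs hodd hpin
    obtain ⟨N, hN, f, hf, -, hsat⟩ := hW1 hcpt _ π hirr hodd' hπ
    refine ⟨N, hN, f, hf, fun v hv => ?_⟩
    obtain ⟨α, hα, hpoly⟩ := hsat v hv
    obtain ⟨hur, hchar⟩ := frobSatakeCompatibleAt_of_isPiOfArtinRep_holds hcpt _ π hπ v α hα
    exact ⟨hur, hpoly ▸ hchar⟩
  · obtain ⟨hcpt, π, hπ⟩ := exists_isPiOfArtinRep_of_not_surjective hAC ρ habs hodd hs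
    obtain ⟨N, hN, f, hf, -, hsat⟩ := hW1 hcpt _ π hirr hodd' hπ
    refine ⟨N, hN, f, hf, fun v hv => ?_⟩
    obtain ⟨α, hα, hpoly⟩ := hsat v hv
    obtain ⟨hur, hchar⟩ := frobSatakeCompatibleAt_of_isPiOfArtinRep_holds hcpt _ π hπ v α hα
    exact ⟨hur, hpoly ▸ hchar⟩

/-- **THE GEN-7 PLAN FOR THE STUB AS TYPED (PROVED)**: pinned road + its complement. -/
theorem stub_modThree_of_planG7 (hPinned : SigStubModThreePinned)
    (hOff : ∀ (W : WeierstrassCurve ℚ) [W.IsElliptic] (ρ : ModPGaloisRep ℚ (ZMod 3) 2),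
      W.IsTorsionGaloisRep 3 ρ → FramedRep.IsAbsolutelyIrreducible ρ →
      ¬ HasLanglandsPin ρ → ρ.IsModular) :
    SigStubModThree := by
  intro W _ ρ hρ habs
  by_cases hpin : HasLanglandsPin ρ
  · exact hPinned W ρ hρ habs hpin
  · exact hOff W ρ hρ habs hpin

/-! ### §B′ Which curves are pinned at `ℓ ≡ 2 (mod 3)`: Tate primes with `3 ∤ v_ℓ(j)` -/

/-- **(B2) A TRANSVECTION IN `ρ̄(I_ℓ)` AT A POTENTIALLY MULTIPLICATIVE `ℓ ≠ 3` WITH `3 ∤ v_ℓ(j)`, `M`**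
(Silverman ATAEC V.6 Prop. 6.1 with torsion prime `3` and residue characteristic `ℓ ≠ 3`: "`K(Q)/K`,
`Q = q^{1/3}`, is totally ramified of degree `3`"; the tree PROVES the case residue characteristic =
torsion prime, `exists_inertia_transvection_of_hasMultiplicativeReductionAt_of_not_dvd`
(`MultiplicativeReductionTransvectionProofs`), by the Tate form of invariant `j` and the value group
of `ℚ_ℓ^nr` — the same proof with `ℓ` as uniformiser gives this).  In `GL₂(𝔽₃)` the transvections
are exactly the elements of order `3`. [cite: SilvermanATAEC1994, V.6 Prop. 6.1 (p. 410)] [cite: SerreInventiones1972, §1.12] -/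
theorem exists_inertia_order_three (W : WeierstrassCurve ℚ) [W.IsElliptic] (ℓ : ℕ) [Fact ℓ.Prime]
    (hℓ3 : ℓ ≠ 3) (hj : padicValRat ℓ W.j < 0) (hcube : ¬ (3 : ℤ) ∣ padicValRat ℓ W.j)
    {ρ : ModPGaloisRep ℚ (ZMod 3) 2} (hρ : W.IsTorsionGaloisRep 3 ρ)
    {v : HeightOneSpectrum (𝓞 ℚ)} (hv : (ℓ : 𝓞 ℚ) ∈ v.asIdeal)
    {𝔓 : Ideal (absIntegers (𝓞 ℚ) ℚ)} (h𝔓 : 𝔓 ∈ v.primesAbove) :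
    ∃ τ ∈ 𝔓.inertia (Field.absoluteGaloisGroup ℚ), ρ τ ≠ 1 ∧ ρ τ ^ 3 = 1 := by
  sorry

/-- **(B3) `det ρ̄(Frob_ℓ) = -1` for `ℓ ≡ 2 (mod 3)`, `S`** (PROVED: `det ρ̄ = χ̄₃` by the Weil pairing,
tree `det_eq_modPCyclotomicCharacter_of_isTorsionGaloisRep_holds`, and `χ̄₃(Frob_ℓ) = ℓ`, tree
`Mazur1978.modPCyclotomicCharacterZMod_of_isArithFrobAt`). [folklore] -/
theorem det_frob_eq_neg_one (W : WeierstrassCurve ℚ) [W.IsElliptic] (ℓ : ℕ) [Fact ℓ.Prime]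
    (hℓ : ℓ % 3 = 2) {ρ : ModPGaloisRep ℚ (ZMod 3) 2} (hρ : W.IsTorsionGaloisRep 3 ρ)
    {v : HeightOneSpectrum (𝓞 ℚ)} (hv : (ℓ : 𝓞 ℚ) ∈ v.asIdeal)
    {𝔓 : Ideal (absIntegers (𝓞 ℚ) ℚ)} (h𝔓 : 𝔓 ∈ v.primesAbove)
    {φ : Field.absoluteGaloisGroup ℚ} (hφ : IsArithFrobAt (𝓞 ℚ) φ 𝔓) :
    Matrix.GeneralLinearGroup.det (ρ φ) = -1 := by
  haveI : Fact (Nat.Prime 3) := ⟨Nat.prime_three⟩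
  haveI : NeZero ((3 : ℕ) : ℚ) := ⟨by norm_num⟩
  have hℓ3 : ℓ ≠ 3 := by rintro rfl; norm_num at hℓ
  have h1 := W.det_eq_modPCyclotomicCharacter_of_isTorsionGaloisRep_holds 3 ρ hρ φ
  have h2 := Mazur1978.modPCyclotomicCharacterZMod_of_isArithFrobAt 3 ℓ hℓ3 hv h𝔓 hφ
  ext
  rw [h1, h2, Units.val_neg, Units.val_one, ← ZMod.natCast_mod ℓ 3, hℓ]
  decide

/-- **(B4) finite group theory in `GL₂(𝔽₃)`, `S`**: an element of order `3` commutes with no element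
of determinant `-1` (its centraliser is `{±1}·⟨τ⟩ ⊂ {(a b; 0 a)}`, all of square determinant).
`decide` over `48²` pairs, or the two-line centraliser computation. [folklore] -/
theorem not_commute_of_order_three_of_det_eq_neg_one (τ φ : GL (Fin 2) (ZMod 3)) (hτ : τ ≠ 1)
    (hτ3 : τ ^ 3 = 1) (hφ : Matrix.GeneralLinearGroup.det φ = -1) : φ * τ ≠ τ * φ := by
  sorry

/-- **(B5) POTENTIALLY MULTIPLICATIVE AT `ℓ ≡ 2 (mod 3)` WITH `3 ∤ v_ℓ(j)` ⇒ PINNED AT `ℓ`, `M`**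
(from B2 + B3 + B4: `τ ∈ I_𝔓 ≤ D_𝔓` of order `3`, an arithmetic Frobenius `φ ∈ D_𝔓` (exists) with
`det = -1` — bits (i), (ii); bit (iii): `D_𝔓` normalises `ρ̄(I_𝔓) ⊆ {±1}·⟨τ⟩`, hence fixes the
unique `τ`-fixed line, so `ρ̄(D_𝔓)` lies in a Borel (order `12`) and misses `18` elements of `SL₂(𝔽₃)`).
`ℓ = 2` is allowed. [cite: SilvermanATAEC1994, V.6 Prop. 6.1] [cite: SerreInventiones1972, §1.12, §2.6] -/
theorem hasLanglandsPinAt_of_padicValRat_j_neg (W : WeierstrassCurve ℚ) [W.IsElliptic] (ℓ : ℕ)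
    [Fact ℓ.Prime] (hℓ : ℓ % 3 = 2) (hj : padicValRat ℓ W.j < 0)
    (hcube : ¬ (3 : ℤ) ∣ padicValRat ℓ W.j) {ρ : ModPGaloisRep ℚ (ZMod 3) 2}
    (hρ : W.IsTorsionGaloisRep 3 ρ) : HasLanglandsPinAt ℓ ρ := by
  sorry

/-- (B5 ⇒ the gen-7 pin, PROVED.) -/
theorem hasLanglandsPin_of_padicValRat_j_neg (W : WeierstrassCurve ℚ) [W.IsElliptic] (ℓ : ℕ)
    [Fact ℓ.Prime] (hℓ : ℓ % 3 = 2) (hj : padicValRat ℓ W.j < 0)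
    (hcube : ¬ (3 : ℤ) ∣ padicValRat ℓ W.j) {ρ : ModPGaloisRep ℚ (ZMod 3) 2}
    (hρ : W.IsTorsionGaloisRep 3 ρ) : HasLanglandsPin ρ :=
  ⟨ℓ, Fact.out, Or.inr hℓ, hasLanglandsPinAt_of_padicValRat_j_neg W ℓ hℓ hj hcube hρ⟩

/-- **(B6) FREY: every ODD `ℓ ∣ abc` with `ℓ ≡ 2 (mod 3)` and `3 ∤ v_ℓ(abc)` PINS, `S`** given B5
(`j(E_(a,b)) = 2⁸ (a² + ab + b²)³ / (ab(a+b))²`, tree `j_freyCurve`; `ℓ ∤ a² + ab + b²` for `ℓ ∣ ab(a+b)`,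
`gcd(a, b) = 1`; so `v_ℓ(j) = -2 v_ℓ(abc) < 0` and `3 ∤ v_ℓ(j) ⇔ 3 ∤ v_ℓ(abc)`).
[cite: Serre1987, §4.1 (4.1.9)] -/
theorem hasLanglandsPin_freyCurve_of_dvd {a b : ℤ} (hab : IsCoprime a b) (h0 : a * b * (a + b) ≠ 0)
    (ℓ : ℕ) [Fact ℓ.Prime] (hℓ : ℓ % 3 = 2) (hℓ2 : ℓ ≠ 2) (hdvd : (ℓ : ℤ) ∣ a * b * (a + b))
    (hval : ¬ 3 ∣ multiplicity (ℓ : ℤ) (a * b * (a + b))) {ρ : ModPGaloisRep ℚ (ZMod 3) 2}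
    (hρ : (freyCurve a b).IsTorsionGaloisRep 3 ρ) : HasLanglandsPin ρ := by
  sorry

/-- **(B6₂) FREY AT `ℓ = 2`, `S`** given B5: with `v = v₂(abc) ≥ 5` the curve is (potentially)
multiplicative at `2` with `v₂(j) = 8 - 2v < 0`, and `3 ∤ 8 - 2v ⇔ v ≢ 1 (mod 3)`.
[cite: Serre1987, §4.1 (4.1.9)–(4.1.11)] [cite: DiamondKramer1995, §1] -/
theorem hasLanglandsPin_freyCurve_two {a b : ℤ} (hab : IsCoprime a b) (h0 : a * b * (a + b) ≠ 0)
    (h5 : 5 ≤ multiplicity (2 : ℤ) (a * b * (a + b)))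
    (hmod : multiplicity (2 : ℤ) (a * b * (a + b)) % 3 ≠ 1) {ρ : ModPGaloisRep ℚ (ZMod 3) 2}
    (hρ : (freyCurve a b).IsTorsionGaloisRep 3 ρ) : HasLanglandsPin ρ := by
  sorry

/-- **(N3ᵘ) UNIT NON-CUBES AT `3` ALSO PIN, `S/M` (new in generation 7).**  Generation 6's N3
pinned the Tate curves at `3` with `3 ∤ v₃(j)`; but `ρ̄(D₃)` is non-abelian as soon as the Tate
parameter `q ∉ ℚ₃ˣ³` (image of `D₃` in the Borel `𝔽₃ ⋊ 𝔽₃ˣ ≅ S₃` with `χ̄₃|_{D₃}` onto `{±1}` and a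
non-zero Kummer class is all of `S₃`).  For the Frey curve with `3 ∣ abc`, `v = v₃(abc)`,
`u = abc / 3^v`: `q = j⁻¹(1 + O(3⁶))`, `j⁻¹ = u² 3^{2v} / (2⁸ (a² + ab + b²)³)` and `2⁸ ≡ 4 · 2⁶`, so
`q ∈ ℚ₃ˣ³ ⇔ 3 ∣ v ∧ u² ≡ 4 (mod 9) ⇔ 3 ∣ v ∧ u ≡ ±2 (mod 9)`.  Hence `u ≢ ±2 (mod 9)` pins.
(Derived here; cheap to confirm numerically.) [cite: SilvermanATAEC1994, V.3 Thm. 3.1, V.6 Prop. 6.1] [cite: Serre1987, §4.1] -/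
theorem hasLanglandsPin_freyCurve_of_unit_noncube {a b : ℤ} (hab : IsCoprime a b)
    (h0 : a * b * (a + b) ≠ 0) (h3 : (3 : ℤ) ∣ a * b * (a + b))
    (hu : ¬ ((a * b * (a + b)) / 3 ^ multiplicity (3 : ℤ) (a * b * (a + b)) % 9 = 2 ∨
      (a * b * (a + b)) / 3 ^ multiplicity (3 : ℤ) (a * b * (a + b)) % 9 = 7))
    {ρ : ModPGaloisRep ℚ (ZMod 3) 2} (hρ : (freyCurve a b).IsTorsionGaloisRep 3 ρ) :
    HasLanglandsPin ρ := by
  sorry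

/-! ### §B″ The switch the residual cell needs -/

/-- **(SW₃) generation 5's switch, verbatim** (for comparison). [cite: RubinCSS1997, Prop. 11, Lemma 12, §4] -/
def SwitchTateAtThree : Prop :=
  ∀ (W : WeierstrassCurve ℚ) [W.IsElliptic], padicValRat 3 W.j < 0 → ¬ 27 ∣ W.conductorNorm ℤ →
    ∀ (ρ : ModPGaloisRep ℚ (ZMod 5) 2), W.IsTorsionGaloisRep 5 ρ → ρ.IsAbsIrreducibleOverSqrt 5 →
      ∃ (W' : WeierstrassCurve ℚ) (_ : W'.IsElliptic), W'.IsTorsionGaloisRep 5 ρ ∧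
        padicValRat 3 W'.j < 0 ∧ ¬ (3 : ℤ) ∣ padicValRat 3 W'.j ∧
        ∃ ρ₃' : ModPGaloisRep ℚ (ZMod 3) 2, W'.IsTorsionGaloisRep 3 ρ₃' ∧
          ρ₃'.IsAbsIrreducibleOverSqrt (-3)

/-- **(B7) NEW, WEAKER SWITCH `SwitchToPinned`**: as SW₃ but the switched curve `W'` need only be a
non-cube Tate curve at SOME non-split prime (`3`, or `ℓ ≡ 2 (mod 3)`) — on Rubin's `X_E(5) ≅ ℙ¹`
the extra condition at an auxiliary `ℓ ≡ 2 (3)` is a congruence on the parameter mod `ℓ²` (a simple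
root of the degree-`12` cusp form `f_E(t)` mod `ℓ`, Hensel), instead of SW₃'s `3`-adic cube classes.
[cite: RubinCSS1997, Prop. 11, Lemma 12, §4] [cite: SilvermanATAEC1994, V.6 Prop. 6.1] -/
def SwitchToPinned : Prop :=
  ∀ (W : WeierstrassCurve ℚ) [W.IsElliptic], padicValRat 3 W.j < 0 → ¬ 27 ∣ W.conductorNorm ℤ →
    ∀ (ρ : ModPGaloisRep ℚ (ZMod 5) 2), W.IsTorsionGaloisRep 5 ρ → ρ.IsAbsIrreducibleOverSqrt 5 →
      ∃ (W' : WeierstrassCurve ℚ) (_ : W'.IsElliptic), W'.IsTorsionGaloisRep 5 ρ ∧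
        padicValRat 3 W'.j < 0 ∧
        (∃ ℓ : ℕ, ℓ.Prime ∧ (ℓ = 3 ∨ ℓ % 3 = 2) ∧ padicValRat ℓ W'.j < 0 ∧
          ¬ (3 : ℤ) ∣ padicValRat ℓ W'.j) ∧
        ∃ ρ₃' : ModPGaloisRep ℚ (ZMod 3) 2, W'.IsTorsionGaloisRep 3 ρ₃' ∧
          ρ₃'.IsAbsIrreducibleOverSqrt (-3)

/-- (PROVED) `SwitchToPinned` asks for LESS than SW₃. -/
theorem switchToPinned_of_switchTateAtThree (h : SwitchTateAtThree) : SwitchToPinned := by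
  intro W _ hj h27 ρ hρ hirr
  obtain ⟨W', hW', hρ', hj', hcube, ρ₃', h₃, hirr₃⟩ := h W hj h27 ρ hρ hirr
  exact ⟨W', hW', hρ', hj', ⟨3, Nat.prime_three, Or.inl rfl, hj', hcube⟩, ρ₃', h₃, hirr₃⟩

/-! ### §C The totally unpinned Frey cell (what the switch must still carry) -/

/-- **(C1) THE RESIDUAL CELL, `S`** (contrapositives of generation 6's N2 (`3 ∤ abc` ⇒ pinned at `3`),
N3 (`3 ∤ v₃(j)` ⇒ pinned at `3`), N3ᵘ and B6/B6₂): an UNPINNED Frey curve has `v₃(abc) ≥ 3` with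
`3 ∣ v₃(abc)` and `abc/3^{v₃} ≡ ±2 (mod 9)`, every odd `ℓ ≡ 2 (3)` dividing `abc` to a multiplicity divisible by `3`, and
`v₂(abc) ≥ 5 ⇒ v₂(abc) ≡ 1 (3)`.  Smallest member: `27 + 112 = 139`. [cite: Serre1987, §4.1] -/
theorem residualCell_of_not_hasLanglandsPin {a b : ℤ} (hab : IsCoprime a b) (h0 : a * b * (a + b) ≠ 0)
    {ρ : ModPGaloisRep ℚ (ZMod 3) 2} (hρ : (freyCurve a b).IsTorsionGaloisRep 3 ρ)
    (hpin : ¬ HasLanglandsPin ρ) :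
    3 ≤ multiplicity (3 : ℤ) (a * b * (a + b)) ∧ 3 ∣ multiplicity (3 : ℤ) (a * b * (a + b)) ∧
    ((a * b * (a + b)) / 3 ^ multiplicity (3 : ℤ) (a * b * (a + b)) % 9 = 2 ∨
      (a * b * (a + b)) / 3 ^ multiplicity (3 : ℤ) (a * b * (a + b)) % 9 = 7) ∧
    (∀ ℓ : ℕ, ℓ.Prime → ℓ % 3 = 2 → ℓ ≠ 2 → (ℓ : ℤ) ∣ a * b * (a + b) →
      3 ∣ multiplicity (ℓ : ℤ) (a * b * (a + b))) ∧
    (5 ≤ multiplicity (2 : ℤ) (a * b * (a + b)) → multiplicity (2 : ℤ) (a * b * (a + b)) % 3 = 1) := by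
  sorry

end Summit.ABC.ABC.Cruxes.FreyModularity.StubIdeasModThree3G7

end
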